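import Literature.NumberTheory.Kottwitz1992.ComplexPointsLocalIsoRealHolds
import Literature.LinearAlgebra.Matrix.IsometryConjugacyAlgClosed
import HarnessLib

/-!
# [Kottwitz1992, Lemma 7.1 (p. 395)] conjugacy in `G(K)` — DISCHARGED: `Kottwitz1992_7_1_conj_iff_holds`

Kernel-lane companion of the statement carpet ★ `Literature/NumberTheory/Kottwitz1992/GroupStructure.lean` (squad TK, seat
TK-t03): the named fact ★ `GroupStructure.Kottwitz1992_7_1_conj_iff` — for the rational datum `(B, *, V, (·,·))` of §5, an
algebraically closed field `K ⊇ ℚ` and a presentation `(B_K, ι_K; V_K, φ_K)` of the extension of scalars, two elements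
`x, y ∈ G(K)` (similitudes of `(V_K, φ_K)`) are `G(K)`-conjugate iff `c(x) = c(y)` and `x, y` are conjugate in
`H(K) = Aut_{B_K}(V_K)` — is PROVED here as `theorem Kottwitz1992_7_1_conj_iff_holds`.  THEOREMS ONLY (no definition, no
named fact, no `sorry`, no instance, no notation); cell hodgecm-mathlib, seat B-typ04 (g31); net debt −1.

R. E. Kottwitz, *Points on some Shimura varieties over finite fields*, J. Amer. Math. Soc. 5 (1992), §7 p. 395 (held
`paper:doi-10-2307-2152772`, p0022 L44 – p0023 L19).  THE PRINT: «**Lemma 7.1.** Two elements `x, y` of `G(K)` are conjugate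
if and only if `c(x) = c(y)` and `i(x)`, `i(y)` are conjugate in `H(K)`.  Suppose that `c(x) = c(y)` and that `i(x)`, `i(y)`
are conjugate in `H(K)`. We want to show that `x, y` are conjugate. Modifying `x, y` by the same scalar, we may assume that
`c(x) = c(y) = 1`, so that `x, y ∈ G₁(K)`. Over `K` the groups `G₁` and `H` decompose as products of factors indexed by the
embeddings of `F₀` in `K`. Thus we may reduce to the case in which `G₁ ↪ H` is of one of the three following types: (A)
`GL_n ↪ GL_n × GL_n` (diagonal map), (C) `Sp_{2n} ↪ GL_{2n}`, (D) `O_{2n} ↪ GL_{2n}`. Case A is trivial and Cases C and D are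
dealt with in the fourth chapter of the article by Springer and Steinberg in [B].»

THE PROOF GIVEN HERE.  The Springer–Steinberg argument for one classical factor is in the tree
(★ `Literature.LinearAlgebra.Matrix.IsometryConjugacyAlgClosed`, lane lit-hodgefound: if `g x g⁻¹ = y` then `s = g*g`
commutes with `x` and is self-adjoint; an invertible matrix over an algebraically closed field of characteristic `≠ 2` has a
square root `p(s)` POLYNOMIAL in `s`; `k = g p(s)⁻¹` is an isometry conjugating `x` to `y`).  That argument does not see the
factorisation: it runs verbatim in the finite-dimensional `K`-algebra with involution `C_K = End_{B_K}(V_K)`, so the printed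
reduction «over `K` the groups `G₁` and `H` decompose as products of factors» is NOT needed and is not formalised.  Concretely
(⇐): from `g x = y g` and `c(x) = c(y)`, the endomorphism `h = g*g` defined by `φ_K(h w, v) = φ_K(g w, g v)` (Mathlib
`LinearMap.BilinForm.symmCompOfNondegenerate`; `φ_K` is nondegenerate, alternating and skew-Hermitian by
★ `ComplexPoints.LocalIsoReal.form_nondegenerate ∕ form_swap ∕ form_smul_left`) is `B_K`-linear, self-adjoint, invertible
and commutes with `x`; the square root `z = p(h)` (★ `IsometryConjugacy.exists_aeval_sq_eq_of_isAlgClosed`, transported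
to `C_K` along the injective `Algebra.leftMulMatrix`) is again self-adjoint, invertible and commutes with `x`; and `g' = g z⁻¹`
has multiplier `1` and `g' x g'⁻¹ = y`.  (⇒): `c(g x g⁻¹) = c(g) c(x) c(g)⁻¹ = c(x)`.
HONEST LABEL: HC_CM is proved only modulo the 7 printed citations (2 remaining: hLiu418, h413) until rung 0 closes; this file adds no
citation debt (0 facts, 0 sorry) and discharges 1 named fact of ★ `GroupStructure`.

## References
* [Kottwitz1992] R. E. Kottwitz, Points on some Shimura varieties over finite fields, J. Amer. Math. Soc. 5 (1992) 373–444, §7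
  Lemma 7.1 p. 395.
* [SpringerSteinberg1970] T. A. Springer, R. Steinberg, Conjugacy classes, in: Seminar on algebraic groups and related finite
  groups, LNM 131 (1970), Ch. IV (cited through Kottwitz's pointer; not held).
-/

noncomputable section

namespace Literature.NumberTheory.Kottwitz1992.GroupStructure

open Module Polynomial
open Literature.NumberTheory.Kottwitz1992.ComplexPoints

namespace Lemma71

/-! ## §1. Square roots of units in a finite-dimensional algebra over an algebraically closed field -/

/-- A unit of a finite-dimensional algebra over an algebraically closed field with `2 ≠ 0` has a square root which is a
polynomial in it (the tree's matrix statement ★ `IsometryConjugacy.exists_aeval_sq_eq_of_isAlgClosed`, transported along the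
left regular representation `Algebra.leftMulMatrix`). [cite: Kottwitz1992, §7 Lemma 7.1 (p. 395)] -/
private theorem exists_aeval_sq_eq {K : Type*} [Field K] [IsAlgClosed K] {A : Type*} [Ring A] [Algebra K A]
    [Module.Finite K A] (h2 : (2 : K) ≠ 0) {s : A} (hs : IsUnit s) : ∃ p : K[X], (aeval s p) ^ 2 = s := by
  classical
  let b := Module.finBasis K A
  have hM : IsUnit (Algebra.leftMulMatrix b s).det :=
    (Matrix.isUnit_iff_isUnit_det _).mp (hs.map (Algebra.leftMulMatrix b))
  obtain ⟨p, hp⟩ := Literature.LinearAlgebra.Matrix.IsometryConjugacy.exists_aeval_sq_eq_of_isAlgClosed h2 hM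
  refine ⟨p, Algebra.leftMulMatrix_injective b ?_⟩
  rw [map_pow, ← Polynomial.aeval_algHom_apply, hp]

/-! ## §2. The involution trick in `C_K = End_{B_K}(V_K)` -/

section Core

variable {K : Type*} [Field K]
variable {BK : Type*} [Ring BK] [Algebra K BK]
variable {VK : Type*} [AddCommGroup VK] [Module K VK] [Module BK VK] [IsScalarTower K BK VK]

/-- `End_{B_K}(V_K)` is finite-dimensional over `K` when `V_K` is. [folklore] -/
private theorem finite_end [FiniteDimensional K VK] : Module.Finite K (Module.End BK VK) := by
  let f : Module.End BK VK →ₗ[K] Module.End K VK :=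
    { toFun := fun T => T.restrictScalars K
      map_add' := fun _ _ => rfl
      map_smul' := fun _ _ => rfl }
  exact Module.Finite.of_injective f (LinearMap.restrictScalars_injective K)

/-- Polynomials in a self-adjoint endomorphism are self-adjoint. [folklore] -/
private theorem aeval_selfAdjoint (φK : LinearMap.BilinForm K VK) (h : Module.End BK VK)
    (hsa : ∀ w v, φK (h w) v = φK w (h v)) (p : K[X]) (w v : VK) :
    φK (aeval h p w) v = φK w (aeval h p v) := by
  have hpow : ∀ (n : ℕ) (w v : VK), φK ((h ^ n) w) v = φK w ((h ^ n) v) := by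
    intro n
    induction n with
    | zero => intro w v; simp
    | succ n ih =>
      intro w v
      calc φK ((h ^ (n + 1)) w) v = φK (h ((h ^ n) w)) v := by rw [pow_succ', Module.End.mul_apply]
        _ = φK w ((h ^ n) (h v)) := by rw [hsa, ih]
        _ = φK w ((h ^ (n + 1)) v) := by rw [pow_succ, Module.End.mul_apply]
  induction p using Polynomial.induction_on' generalizing w v with
  | add p q hp hq => simp only [map_add, LinearMap.add_apply, hp, hq]
  | monomial n a =>
    simp only [aeval_monomial, Algebra.algebraMap_eq_smul_one, smul_one_mul, LinearMap.smul_apply, map_smul,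
      smul_eq_mul, hpow]

/-- **The heart of Lemma 7.1** (Springer–Steinberg for the algebra with involution `End_{B_K}(V_K)`): if `g x = y g`
in `H(K)` and `x`, `y` have the same multiplier for the nondegenerate alternating skew-Hermitian form `φ_K`, then some
ISOMETRY `g'` (multiplier `1`) has `g' x = y g'`. [cite: Kottwitz1992, §7 Lemma 7.1 (p. 395)] -/
private theorem exists_isometry_semiconj [IsAlgClosed K] [CharZero K] [FiniteDimensional K VK] (ιK : BK →ₗ[K] BK)
    (φK : LinearMap.BilinForm K VK) (hnd : φK.Nondegenerate) (halt : ∀ u v, φK u v = -φK v u)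
    (hskew : ∀ (b : BK) (u v : VK), φK (b • u) v = φK u (ιK b • v))
    (x y g : (Module.End BK VK)ˣ) (c : K)
    (hxc : ∀ u v, φK ((x : Module.End BK VK) u) ((x : Module.End BK VK) v) = c * φK u v)
    (hyc : ∀ u v, φK ((y : Module.End BK VK) u) ((y : Module.End BK VK) v) = c * φK u v)
    (hg : ((g : Module.End BK VK) * x : Module.End BK VK) = y * g) :
    ∃ g' : (Module.End BK VK)ˣ,
      (∀ u v, φK ((g' : Module.End BK VK) u) ((g' : Module.End BK VK) v) = φK u v) ∧
        ((g' : Module.End BK VK) * x : Module.End BK VK) = y * g' := by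
  classical
  haveI : Module.Finite K (Module.End BK VK) := finite_end
  -- shorthands for the `K`-linear maps
  set G : VK →ₗ[K] VK := (g : Module.End BK VK).restrictScalars K with hGdef
  have hGap : ∀ w, G w = (g : Module.End BK VK) w := fun w => rfl
  -- inverses act as inverses
  have hgi : ∀ v, (g : Module.End BK VK) ((↑g⁻¹ : Module.End BK VK) v) = v := fun v => by
    rw [← Module.End.mul_apply, Units.mul_inv, Module.End.one_apply]
  have hig : ∀ v, (↑g⁻¹ : Module.End BK VK) ((g : Module.End BK VK) v) = v := fun v => by
    rw [← Module.End.mul_apply, Units.inv_mul, Module.End.one_apply]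
  have hxi : ∀ v, (x : Module.End BK VK) ((↑x⁻¹ : Module.End BK VK) v) = v := fun v => by
    rw [← Module.End.mul_apply, Units.mul_inv, Module.End.one_apply]
  -- §a. `h = g* g`: `φ(h w, v) = φ(g w, g v)`
  let ψ : LinearMap.BilinForm K VK := φK.comp G G
  let h0 : VK →ₗ[K] VK := ψ.symmCompOfNondegenerate φK hnd
  have hh0 : ∀ w v, φK (h0 w) v = φK ((g : Module.End BK VK) w) ((g : Module.End BK VK) v) := fun w v => by
    rw [LinearMap.BilinForm.symmCompOfNondegenerate_left_apply, LinearMap.BilinForm.comp_apply]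
    rfl
  -- a vector orthogonal to everything vanishes
  have hsep : ∀ m : VK, (∀ n, φK m n = 0) → m = 0 := fun m hm => hnd.1 m hm
  -- §b. `h` is `B_K`-linear
  have hlin : ∀ (b : BK) (w : VK), h0 (b • w) = b • h0 w := by
    intro b w
    rw [← sub_eq_zero]
    refine hsep _ fun v => ?_
    simp only [map_sub, LinearMap.sub_apply, hh0, map_smul, hskew, sub_self]
  let h : Module.End BK VK :=
    { toFun := h0
      map_add' := fun a b => h0.map_add a b
      map_smul' := fun b w => hlin b w }
  have hh : ∀ w v, φK (h w) v = φK ((g : Module.End BK VK) w) ((g : Module.End BK VK) v) := hh0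
  -- §c. `h` is self-adjoint
  have hsa : ∀ w v, φK (h w) v = φK w (h v) := fun w v => by
    rw [hh, halt, ← hh, ← halt]
  -- §d. `h` commutes with `x`
  have hgx : ∀ w, (g : Module.End BK VK) ((x : Module.End BK VK) w) =
      (y : Module.End BK VK) ((g : Module.End BK VK) w) := fun w => by
    rw [← Module.End.mul_apply, hg, Module.End.mul_apply]
  have hcomm : h * (x : Module.End BK VK) = x * h := by
    ext w
    rw [Module.End.mul_apply, Module.End.mul_apply, ← sub_eq_zero]
    refine hsep _ fun u => ?_
    rw [← hxi u, map_sub, LinearMap.sub_apply, hh, hgx, hgx, hyc, hxc, hh, sub_self]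
  -- §e. `h` is invertible
  have hinj : Function.Injective h := by
    intro w₁ w₂ hw
    rw [← sub_eq_zero] at hw ⊢
    rw [← map_sub] at hw
    set w := w₁ - w₂
    have hGw : (g : Module.End BK VK) w = 0 := by
      refine hsep _ fun u => ?_
      rw [← hgi u, ← hh, hw, map_zero, LinearMap.zero_apply]
    simpa [hig] using congrArg (↑g⁻¹ : Module.End BK VK) hGw
  have hu : IsUnit h := by
    rw [Module.End.isUnit_iff]
    refine ⟨hinj, ?_⟩
    have : Function.Surjective (h.restrictScalars K) :=
      (LinearMap.injective_iff_surjective (f := h.restrictScalars K)).mp hinj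
    exact this
  -- §f. the square root `z = p(h)`
  obtain ⟨p, hp⟩ := exists_aeval_sq_eq (K := K) two_ne_zero hu
  set z : Module.End BK VK := aeval h p with hzdef
  have hz2 : z * z = h := by rw [← pow_two, hp]
  have hzu : IsUnit z := isUnit_mul_self_iff.mp (hz2 ▸ hu)
  have hzsa : ∀ w v, φK (z w) v = φK w (z v) := aeval_selfAdjoint φK h hsa p
  have hzx : (x : Module.End BK VK) * z = z * x := by
    have hmem : z ∈ Subalgebra.centralizer K {(x : Module.End BK VK)} := by
      refine (Algebra.adjoin_le ?_) (Polynomial.aeval_mem_adjoin_singleton K h)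
      intro t ht
      rw [Set.mem_singleton_iff] at ht
      subst ht
      rw [SetLike.mem_coe, Subalgebra.mem_centralizer_iff]
      intro a ha
      rw [Set.mem_singleton_iff] at ha
      subst ha
      exact hcomm.symm
    rw [Subalgebra.mem_centralizer_iff] at hmem
    exact hmem _ (Set.mem_singleton _)
  -- §g. `g' = g z⁻¹`
  let Z : (Module.End BK VK)ˣ := hzu.unit
  have hZ : (Z : Module.End BK VK) = z := hzu.unit_spec
  have hZx : Commute x Z := Units.ext (by rw [Units.val_mul, Units.val_mul, hZ, hzx])
  have hzZi : ∀ v, z ((↑Z⁻¹ : Module.End BK VK) v) = v := fun v => by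
    rw [← hZ, ← Module.End.mul_apply, Units.mul_inv, Module.End.one_apply]
  refine ⟨g * Z⁻¹, fun u v => ?_, ?_⟩
  · rw [Units.val_mul, Module.End.mul_apply, Module.End.mul_apply, ← hh]
    have : h ((↑Z⁻¹ : Module.End BK VK) u) = z u := by
      rw [← hz2, Module.End.mul_apply, hzZi]
    rw [this, hzsa, hzZi]
  · have hgU : g * x = y * g := Units.ext hg
    have h1 : g * Z⁻¹ * x = y * (g * Z⁻¹) := by
      rw [mul_assoc, ← hZx.inv_right.eq, ← mul_assoc, hgU, mul_assoc]
    have h2 := congrArg (fun u : (Module.End BK VK)ˣ => (u : Module.End BK VK)) h1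
    simpa only [Units.val_mul] using h2

end Core

end Lemma71

/-! ## §3. Lemma 7.1 -/

section Statement

variable {B : Type} [Ring B] [Algebra ℚ B] (ι : B →ₗ[ℚ] B)
variable {V : Type} [AddCommGroup V] [Module ℚ V] [Module B V] (φ : LinearMap.BilinForm ℚ V)
variable (K : Type) [Field K] [Algebra ℚ K]
variable {BK : Type} [Ring BK] [Algebra K BK] [Algebra ℚ BK] [IsScalarTower ℚ K BK] (ιK : BK →ₗ[K] BK)
  (jB : B →ₐ[ℚ] BK)
variable {VK : Type} [AddCommGroup VK] [Module K VK] [Module ℚ VK] [IsScalarTower ℚ K VK] [Module BK VK]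
  [IsScalarTower K BK VK] (φK : LinearMap.BilinForm K VK) (jV : V →ₗ[ℚ] VK)
variable [IsAlgClosed K] [CharZero K]

open Lemma71 in
/-- **[Kottwitz1992, Lemma 7.1 (p. 395)]**, DISCHARGED: «Two elements `x, y` of `G(K)` are conjugate if and only if
`c(x) = c(y)` and `i(x)`, `i(y)` are conjugate in `H(K)`» — for the rational datum of §5, `K` algebraically closed of
characteristic `0`, and any presentation of the extension of scalars to `K`. [cite: Kottwitz1992, Lemma 7.1 (p. 395)] -/
theorem Kottwitz1992_7_1_conj_iff_holds : Kottwitz1992_7_1_conj_iff ι φ K ιK jB φK jV := by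
  intro hR hA hM x y hx hy
  haveI := hR.finiteDimensionalV
  haveI : FiniteDimensional K VK := Module.Finite.equiv hM.isBaseChange.equiv
  have hnd : φK.Nondegenerate := LocalIsoReal.form_nondegenerate hM hR.skewHermitian.nondegenerate
  have halt : ∀ u v, φK u v = -φK v u := LocalIsoReal.form_swap hM hR.skewHermitian.isAlt
  have hskew : ∀ (b : BK) (u v : VK), φK (b • u) v = φK u (ιK b • v) :=
    LocalIsoReal.form_smul_left hA hM hR.skewHermitian
  have hinv : ∀ (g : (Module.End BK VK)ˣ) (cg : Kˣ),
      (∀ v w, φK ((g : Module.End BK VK) v) ((g : Module.End BK VK) w) = (cg : K) * φK v w) →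
      ∀ v w, φK ((↑g⁻¹ : Module.End BK VK) v) ((↑g⁻¹ : Module.End BK VK) w) = (cg : K)⁻¹ * φK v w := by
    intro g cg hcg v w
    have hgi : ∀ v, (g : Module.End BK VK) ((↑g⁻¹ : Module.End BK VK) v) = v := fun v => by
      rw [← Module.End.mul_apply, Units.mul_inv, Module.End.one_apply]
    have := hcg ((↑g⁻¹ : Module.End BK VK) v) ((↑g⁻¹ : Module.End BK VK) w)
    rw [hgi, hgi] at this
    rw [this, ← mul_assoc, inv_mul_cancel₀ cg.ne_zero, one_mul]
  constructor
  · rintro ⟨g, hg, hgxy⟩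
    obtain ⟨cx, hcx⟩ := hx
    obtain ⟨cg, hcg⟩ := hg
    refine ⟨⟨(cx : K), hcx, fun v w => ?_⟩, isConj_iff.mpr ⟨g, hgxy⟩⟩
    rw [← hgxy, Units.val_mul, Units.val_mul, Module.End.mul_apply, Module.End.mul_apply, Module.End.mul_apply,
      Module.End.mul_apply, hcg, hcx, hinv g cg hcg, ← mul_assoc, ← mul_assoc, mul_comm (cg : K) (cx : K),
      mul_assoc (cx : K), mul_inv_cancel₀ cg.ne_zero, mul_one]
  · rintro ⟨⟨c, hxc, hyc⟩, hconj⟩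
    obtain ⟨g, hg⟩ := isConj_iff.mp hconj
    have hgU : g * x = y * g := by rw [← hg]; group
    have hg' : ((g : Module.End BK VK) * x : Module.End BK VK) = y * g := by
      have := congrArg (fun u : (Module.End BK VK)ˣ => (u : Module.End BK VK)) hgU
      simpa only [Units.val_mul] using this
    obtain ⟨g', hg'1, hg'2⟩ := exists_isometry_semiconj ιK φK hnd halt hskew x y g c hxc hyc hg'
    have hgU' : g' * x = y * g' := Units.ext (by simpa only [Units.val_mul] using hg'2)
    refine ⟨g', ⟨1, fun v w => by rw [hg'1, Units.val_one, one_mul]⟩, ?_⟩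
    rw [hgU', mul_inv_cancel_right]

end Statement

end Literature.NumberTheory.Kottwitz1992.GroupStructure
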